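import Summits.AtomisticToContinuum.HydrodynamicLimit.Theorems.StiffCollisionalRelaxationAprioriBoundsFibreDefsR4
import Summits.AtomisticToContinuum.HydrodynamicLimit.Theorems.StiffCollisionalRelaxationAprioriBoundsMesoMeanFloorEquilibrium
import Summits.AtomisticToContinuum.HydrodynamicLimit.Theorems.JParityClosureOddContactSymmetryGibbsInvariance
import Summits.AtomisticToContinuum.HydrodynamicLimit.Theorems.BoxDissipativeWeakStrongLocalGibbsFineScaleTreeL1
import Literature.MathematicalPhysics.KineticTheory.HardSphereUniformGas
import Literature.MathematicalPhysics.KineticTheory.HardSphereCanonicalPairBound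
import HarnessLib

/-!
# Poisson-order variance of the kernel block density at homogeneous data (equilibrium instance of stub
# `stub_mesoVariance`, line `meso-chebyshev-window`, crux `AprioriBounds`, stmt-AtomisticToContinuum-14827)

Helper file (`--supports stmt-AtomisticToContinuum-14827`) landing the registered anchor `mesoVariance_homogeneous`: the
conclusion block of stub 3 `stub_mesoVariance` of `Cruxes/AprioriBounds/Lines/meso_chebyshev_window.lean` — the POISSON-ORDER
VARIANCE `Var_{P_N} ρ̄_φ(s,x) ≤ A (N+1)^{3γ−1}` of the kernel block density
`ρ̄_φ(s,x)(z) = empiricalDensityField ((Φ N).flow s z) (fun y => φ N (y - x)) = (N+1)⁻¹ ∑ᵢ φ_N(qᵢ(s) − x)` and its membership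
in `L²(P_N)` — VERBATIM, at CONSTANT profiles `(a₀, u₀, θ₀) ≡ (a, u, θ)`, for EVERY family of hard-sphere flows, every horizon,
every `γ > 0` and every admissible kernel family: the first kernel-checked statement that the `N^{-γ}`-smoothed density of the
dilute hard-sphere Gibbs state has Poisson-order fluctuations.

* §1 UNIFORM ONE-POINT IDENTITY (`mesoVar_Md_uniform`): for the uniform profile the decorated partition functions of the canonical
  cluster expansion (`HardSphereCanonicalTorus`) factorise EXACTLY, `M^χ(m) = (∫χ) Ξ(m)` for every label count `m` (diagonal
  shift invariance of Haar measure on `(𝕋³)ⁿ` and of the hard core; Fubini over the shift).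
* §2 TRUNCATED TWO-POINT FUNCTION (`mesoVar_twoPt_uniform_sub_sq`, `mesoVar_abs_twoPt_uniform_sub_sq_le`): in the two-point
  decorated expansion `Ξ E[χ(x₀)χ(x₁)] = ∑_j C(N−1,j) W^χ(j+1) M^χ(N−j) + R(χ,χ)` (`integral_two_point_eq`, Pulvirenti–
  Tsagkarogiannis §3) the main sum is `(∫χ) ∑_j C(N−1,j) W^χ(j+1) Ξ(N−j)` by §1, and the SAME expansion with the decoration `1`
  at `x₁` identifies that sum with `M^χ(N+1) − R(χ,1) = (∫χ) Ξ(N+1) − R(χ,1)`.  Hence, exactly,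
  `E[χ(x₀)χ(x₁)] − (∫χ)² = (R(χ,χ) − (∫χ) R(χ,1)) / Ξ`, and both same-block remainders are `O(‖χ‖₁ ‖·‖∞ p_{ε_N})` by the
  landed `L¹ × sup` tree bound `LGFS.abs_sameBlockRem_div_le_L1` (`p_{ε_N} = λ/(N+1)`, `λ = v₁σ³`):
  `|Cov| ≤ 4e²S (λ/(N+1)) ‖χ‖₁ (‖χ‖∞ + |∫χ|)` — LINEAR in `‖χ‖∞`, as a kernel of height `C(N+1)^{3γ}` and unit mass needs
  (the quadratic bound `abs_sameBlockRem_le` of the tree would only give `(N+1)^{6γ−1}`).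
* §3 STATICS (`mesoVar_posGibbs_sq_dev_le`): the variance identity of `HardSphereEulerLLN` (exchangeability) under the homogeneous
  canonical gas `posGibbsMeasure a ε_N (N+1) = Ξ⁻¹ 𝟙[hard core] dy^{⊗(N+1)}` (`integral_posGibbsMeasure_const`):
  `E((N+1)⁻¹∑ᵢχ(qᵢ) − ∫χ)² = (N+1)⁻¹(∫χ² − (∫χ)²) + (1 − (N+1)⁻¹) Cov ≤ ‖χ‖∞ ‖χ‖₁ (1 + 8e²Sλ)/(N+1)`.
* §4 DYNAMICS ARE IDLE (`mesoVar_variance_blockDensity_flow_le`): the homogeneous local Gibbs law is invariant under every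
  hard-sphere flow (`measurePreserving_flow_localGibbsLaw_const`), the observable is positional and the position marginal is the
  canonical gas (`mesoVar_measurePreserving_pos`), `Var X ≤ E(X − ∫φ)²`, and `χ = φ(· − x)` has `‖χ‖₁ = ‖φ‖₁`.
* §5 THE ANCHOR (`mesoVariance_homogeneous`): `σ₀` from `exists_smallDensity uniformProfile` (`σ₀ < 1/2`: probability laws),
  `A := C (1 + 8e²Sλ)`, `N₀ := 1`, `K = C(N+1)^{3γ}`, `‖φ_N‖₁ = 1`; `MemLp` from boundedness and measurability.

No new definitions, no named facts; axioms `propext`, `Classical.choice`, `Quot.sound`.  References: E. Pulvirenti,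
D. Tsagkarogiannis, Comm. Math. Phys. 316 (2012) 289–306, §3–5; D. Ruelle, *Statistical Mechanics* (1969), §4.2; H. Spohn,
*Large Scale Dynamics of Interacting Particles* (1991), Part I §2.3, Part II §7.
-/

noncomputable section

open MeasureTheory ProbabilityTheory Filter Set Topology
open scoped ENNReal

namespace Summit.AtomisticToContinuum.HydrodynamicLimit.Theorems.MesoChebyshevWindow

open Literature.MathematicalPhysics.KineticTheory Literature.Analysis.FluidPDE
open Summit.AtomisticToContinuum.HydrodynamicLimit.Theorems.AprioriBoundsNegative (PartOneAt PartTwoAt)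
open Summit.AtomisticToContinuum.HydrodynamicLimit.Theorems.VisitLedgerUpscattering (Cfg Flow Flows NiceProfiles)
open Summit.AtomisticToContinuum.HydrodynamicLimit.Theorems.FibreDeficitTransfer
open Literature.MathematicalPhysics.StatisticalMechanics Literature.Probability.LatticeModels

/-! ## §1 The uniform one-point identity `M^χ(m) = (∫ χ) Ξ(m)` -/

/-- The hard-core indicator of any label set is invariant under the diagonal torus shift (minimal-image
distances are shift invariant). -/
theorem mesoVar_efR_add_const (ε : ℝ) {n : ℕ} (x : Fin n → T3) (c : T3) (W : Finset (Fin n)) :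
    efR (Ov ε) (x + fun _ => c) W = efR (Ov ε) x W := by
  have hd : ∀ i j : Fin n, Torus.euclidDist (x i + c) (x j + c) = Torus.euclidDist (x i) (x j) :=
    fun i j => by rw [Torus.euclidDist_eq, Torus.euclidDist_eq, add_sub_add_right_eq_sub]
  have hmem : (x + fun _ => c) ∈ hardCoreSet (Ov ε) W ↔ x ∈ hardCoreSet (Ov ε) W := by
    simp only [hardCoreSet, Set.mem_setOf_eq, Pi.add_apply, Ov, hd]
  rw [efR_eq_indicator, efR_eq_indicator]
  by_cases hx : x ∈ hardCoreSet (Ov ε) W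
  · rw [Set.indicator_of_mem (hmem.2 hx), Set.indicator_of_mem hx, Pi.one_apply, Pi.one_apply]
  · rw [Set.indicator_of_notMem (fun h => hx (hmem.1 h)), Set.indicator_of_notMem hx]

/-- **Uniform one-point identity.**  For the uniform profile (Haar one-particle law), every continuous `χ`
and every label count `m`, the decorated partition function factorises EXACTLY:
`M^χ(m) = ∫ χ(x₀) 𝟙[first m labels non-overlapping] dx = (∫ χ) · Ξ(m)` — the diagonal shift preserves Haar
measure on `(𝕋³)ⁿ` and the hard core, and `∫_c χ(x₀ + c) dc = ∫ χ` (Fubini over the shift). -/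
theorem mesoVar_Md_uniform {ε : ℝ} {n : ℕ} [NeZero n] {χ : T3 → ℝ} (hχ : Continuous χ) (m : ℕ) :
    Md uniformProfile ε n χ m = (∫ y, χ y) * Xi uniformProfile ε n m := by
  obtain ⟨C, -, hC⟩ := exists_forall_abs_le_of_continuous hχ
  have hO := measurableSet_ov ε
  rw [Md, Xi, decPF, ← integral_efR uniformProfile.μ hO (firstLabels n m),
    Literature.MathematicalPhysics.KineticTheory.uniformProfile_μ]
  set W : Finset (Fin n) := firstLabels n m with hW
  set P : Measure (Fin n → T3) := Measure.pi fun _ : Fin n => (volume : Measure T3) with hP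
  haveI : P.IsAddRightInvariant := Measure.pi.isAddRightInvariant _
  have hefm : Measurable fun x : Fin n → T3 => efR (Ov ε) x W := measurable_efR hO W
  have hχm : Measurable χ := hχ.measurable
  -- shift by every `c`
  have step1 : ∀ c : T3, ∫ x, χ (x 0) * efR (Ov ε) x W ∂P = ∫ x, χ (x 0 + c) * efR (Ov ε) x W ∂P := by
    intro c
    have h := integral_add_right_eq_self (μ := P) (fun x => χ (x 0) * efR (Ov ε) x W) (fun _ => c)
    simp only [Pi.add_apply, mesoVar_efR_add_const] at h
    exact h.symm
  -- average over the shift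
  have step2 : ∫ x, χ (x 0) * efR (Ov ε) x W ∂P = ∫ c : T3, ∫ x, χ (x 0 + c) * efR (Ov ε) x W ∂P := by
    simp_rw [← step1]
    rw [integral_const, probReal_univ, one_smul]
  have hint : Integrable (Function.uncurry fun (c : T3) (x : Fin n → T3) => χ (x 0 + c) * efR (Ov ε) x W)
      ((volume : Measure T3).prod P) := by
    have hm : Measurable (Function.uncurry fun (c : T3) (x : Fin n → T3) =>
        χ (x 0 + c) * efR (Ov ε) x W) := by
      show Measurable fun p : T3 × (Fin n → T3) => χ (p.2 0 + p.1) * efR (Ov ε) p.2 W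
      fun_prop
    refine (integrable_const (C * 1)).mono' hm.aestronglyMeasurable (ae_of_all _ fun p => ?_)
    obtain ⟨c, x⟩ := p
    rw [Function.uncurry_apply_pair, Real.norm_eq_abs, abs_mul]
    exact mul_le_mul (hC _) (abs_efR_le_one x W) (abs_nonneg _) ((abs_nonneg _).trans (hC 0))
  rw [step2, integral_integral_swap hint]
  have inner : ∀ x : Fin n → T3, ∫ c : T3, χ (x 0 + c) * efR (Ov ε) x W = (∫ y, χ y) * efR (Ov ε) x W := by
    intro x
    rw [integral_mul_const, integral_add_left_eq_self]
  simp_rw [inner]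
  rw [integral_const_mul]

/-! ## §2 The truncated two-point function of the homogeneous canonical gas -/

section TwoPoint

variable {σ : ℝ}

/-- **Exact two-point identity for the uniform profile.**  For `N + 1 ≥ 2` spheres and continuous bounded
`χ`, `E_{N+1}[χ(x₀)χ(x₁)] − (∫χ)² = (R(χ, χ) − (∫χ) · R(χ, 1)) / Ξ_N(N+1)`, `R` the same-block remainder of
the two-point decorated expansion (`integral_two_point_eq`): the block of `x₀` avoiding `x₁` contributes
`∑_j C(N−1,j) W^χ(j+1) M^χ(N−j) = (∫χ) ∑_j C(N−1,j) W^χ(j+1) Ξ(N−j)` (uniform one-point identity), and the same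
expansion with the decoration `1` at `x₁` identifies the last sum with `M^χ(N+1) − R(χ, 1) = (∫χ) Ξ(N+1) − R(χ,1)`. -/
theorem mesoVar_twoPt_uniform_sub_sq (hs : SmallDensity uniformProfile σ) {χ : T3 → ℝ} (hχ : Continuous χ)
    {K : ℝ} (hK : ∀ y, |χ y| ≤ K) {N : ℕ} (h2 : 2 ≤ N + 1) :
    twoPt uniformProfile σ χ N - (∫ y, χ y) ^ 2 =
      (sameBlockRem uniformProfile (hsDiameter σ N) (N + 1) h2 χ χ -
        (∫ y, χ y) * sameBlockRem uniformProfile (hsDiameter σ N) (N + 1) h2 χ (fun _ => 1)) /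
        XiN uniformProfile σ N (N + 1) := by
  have hχm : Measurable χ := hχ.measurable
  have h1 : ∀ y : T3, |(fun _ : T3 => (1 : ℝ)) y| ≤ 1 := fun _ => by simp
  have hXi := XiN_pos hs.σ_pos.le hs.σ_lt_half hs.ovDensity_lt_one (N := N) (m := N + 1) le_rfl
  rw [XiN] at hXi ⊢
  have hA := integral_two_point_eq (P := uniformProfile) (ε := hsDiameter σ N) (n := N + 1) h2 hχm hχm hK hK
  have hB := integral_two_point_eq (P := uniformProfile) (ε := hsDiameter σ N) (n := N + 1) h2 hχm measurable_const hK h1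
  have hMd : ∀ m, Md uniformProfile (hsDiameter σ N) (N + 1) χ m =
      (∫ y, χ y) * Xi uniformProfile (hsDiameter σ N) (N + 1) m := fun m => mesoVar_Md_uniform hχ m
  -- the left side of `hB` is `M^χ(N+1) = (∫χ) Ξ(N+1)`
  have hBl : ∫ x, χ (x 0) * (fun _ : T3 => (1 : ℝ)) (x ⟨1, h2⟩) * efR (Ov (hsDiameter σ N)) x Finset.univ
      ∂Measure.pi (fun _ : Fin (N + 1) => uniformProfile.μ) =
      (∫ y, χ y) * Xi uniformProfile (hsDiameter σ N) (N + 1) (N + 1) := by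
    rw [← hMd (N + 1), Md, decPF, firstLabels_self]
    exact integral_congr_ae (ae_of_all _ fun x => by simp only [mul_one])
  rw [hBl] at hB
  simp only [Md_one, hMd] at hA hB
  have hsum : ∑ j ∈ Finset.range (N + 1 - 1), (((N + 1 - 2).choose j : ℝ) *
      (Wd uniformProfile (hsDiameter σ N) (N + 1) χ (j + 1) *
        ((∫ y, χ y) * Xi uniformProfile (hsDiameter σ N) (N + 1) (N + 1 - 1 - j)))) =
      (∫ y, χ y) * ∑ j ∈ Finset.range (N + 1 - 1), (((N + 1 - 2).choose j : ℝ) *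
        (Wd uniformProfile (hsDiameter σ N) (N + 1) χ (j + 1) *
          Xi uniformProfile (hsDiameter σ N) (N + 1) (N + 1 - 1 - j))) := by
    rw [Finset.mul_sum]
    exact Finset.sum_congr rfl fun j _ => by ring
  rw [twoPt, dif_pos h2, XiN, hA, hsum, eq_div_iff hXi.ne', sub_mul, div_mul_cancel₀ _ hXi.ne']
  linear_combination (-(∫ y, χ y)) * hB

/-- **Poisson-order bound on the truncated two-point function of the homogeneous canonical gas.**  For
`N ≥ 1`, continuous `χ` with `|χ| ≤ K`:
`|E_{N+1}[χ(x₀)χ(x₁)] − (∫χ)²| ≤ 4e² S · (λ/(N+1)) · ‖χ‖₁ (K + |∫χ|)`, `λ = v₁σ³`, `S = θ/(1−θ)² + (1−θ)⁻¹`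
(`θ = 2eλ`): both same-block remainders carry the factor `p_{ε_N} = λ/(N+1)` and ONE `L¹` norm
(`LGFS.abs_sameBlockRem_div_le_L1`, the `L¹ × sup` tree bound). -/
theorem mesoVar_abs_twoPt_uniform_sub_sq_le (hs : SmallDensity uniformProfile σ) {χ : T3 → ℝ}
    (hχ : Continuous χ) {K : ℝ} (hK : ∀ y, |χ y| ≤ K) {N : ℕ} (hN : 1 ≤ N) :
    |twoPt uniformProfile σ χ N - (∫ y, χ y) ^ 2| ≤
      4 * Real.exp 1 ^ 2 *
        (geomRatio uniformProfile σ / (1 - geomRatio uniformProfile σ) ^ 2 +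
          (1 - geomRatio uniformProfile σ)⁻¹) *
        (ovDensity uniformProfile σ / ((N + 1 : ℕ) : ℝ)) * ((∫ y, |χ y|) * (K + |∫ y, χ y|)) := by
  have h2 : 2 ≤ N + 1 := by omega
  have hχm : Measurable χ := hχ.measurable
  have h1 : ∀ y : T3, |(fun _ : T3 => (1 : ℝ)) y| ≤ 1 := fun _ => by simp
  have hR1 := LGFS.abs_sameBlockRem_div_le_L1 hs hχm hχm hK hK N h2
  have hR2 := LGFS.abs_sameBlockRem_div_le_L1 hs hχm measurable_const hK h1 N h2
  rw [Literature.MathematicalPhysics.KineticTheory.uniformProfile_μ, pOv_hsDiameter] at hR1 hR2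
  rw [mesoVar_twoPt_uniform_sub_sq hs hχ hK h2, sub_div, mul_div_assoc]
  calc |sameBlockRem uniformProfile (hsDiameter σ N) (N + 1) h2 χ χ / XiN uniformProfile σ N (N + 1) -
        (∫ y, χ y) * (sameBlockRem uniformProfile (hsDiameter σ N) (N + 1) h2 χ (fun _ => 1) /
          XiN uniformProfile σ N (N + 1))|
      ≤ |sameBlockRem uniformProfile (hsDiameter σ N) (N + 1) h2 χ χ / XiN uniformProfile σ N (N + 1)| +
        |(∫ y, χ y) * (sameBlockRem uniformProfile (hsDiameter σ N) (N + 1) h2 χ (fun _ => 1) /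
          XiN uniformProfile σ N (N + 1))| := abs_sub _ _
    _ = |sameBlockRem uniformProfile (hsDiameter σ N) (N + 1) h2 χ χ / XiN uniformProfile σ N (N + 1)| +
        |∫ y, χ y| * |sameBlockRem uniformProfile (hsDiameter σ N) (N + 1) h2 χ (fun _ => 1) /
          XiN uniformProfile σ N (N + 1)| := by rw [abs_mul]
    _ ≤ 4 * Real.exp 1 ^ 2 * ((∫ y, |χ y|) * K) *
          (geomRatio uniformProfile σ / (1 - geomRatio uniformProfile σ) ^ 2 +
            (1 - geomRatio uniformProfile σ)⁻¹) * (ovDensity uniformProfile σ / ((N + 1 : ℕ) : ℝ)) +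
        |∫ y, χ y| * (4 * Real.exp 1 ^ 2 * ((∫ y, |χ y|) * 1) *
          (geomRatio uniformProfile σ / (1 - geomRatio uniformProfile σ) ^ 2 +
            (1 - geomRatio uniformProfile σ)⁻¹) * (ovDensity uniformProfile σ / ((N + 1 : ℕ) : ℝ))) :=
        add_le_add hR1 (mul_le_mul_of_nonneg_left hR2 (abs_nonneg _))
    _ = _ := by ring

/-! ## §3 The static variance under the homogeneous canonical gas -/

/-- **Poisson-order second moment of a one-particle average under the homogeneous canonical gas.**  For
`N ≥ 1`, constant activity `a > 0`, continuous `χ` with `|χ| ≤ K`: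
`∫ ((N+1)⁻¹ ∑ᵢ χ(qᵢ) − ∫χ)² dP_N ≤ K ‖χ‖₁ (1 + 8e²Sλ) / (N+1)` — the variance identity of
`HardSphereEulerLLN` (exchangeability), the uniform one-point identity (the mean IS `∫χ`, the diagonal term is
`∫χ² ≤ K‖χ‖₁`) and the two-point bound `mesoVar_abs_twoPt_uniform_sub_sq_le`.  The dependence
`‖χ‖∞ · ‖χ‖₁` (not `‖χ‖∞²`) is what a kernel of height `(N+1)^{3γ}` and unit mass needs. -/
theorem mesoVar_posGibbs_sq_dev_le (hs : SmallDensity uniformProfile σ) {a : ℝ} (ha : 0 < a) {N : ℕ}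
    (hN : 1 ≤ N) {χ : T3 → ℝ} (hχ : Continuous χ) {K : ℝ} (hK : ∀ y, |χ y| ≤ K) :
    ∫ q, ((((N + 1 : ℕ) : ℝ))⁻¹ * ∑ i, χ (q i) - ∫ y, χ y) ^ 2
        ∂posGibbsMeasure (fun _ : T3 => a) (hsDiameter σ N) (N + 1) ≤
      (K * ∫ y, |χ y|) * (1 + 8 * Real.exp 1 ^ 2 *
        (geomRatio uniformProfile σ / (1 - geomRatio uniformProfile σ) ^ 2 +
          (1 - geomRatio uniformProfile σ)⁻¹) * ovDensity uniformProfile σ) / ((N + 1 : ℕ) : ℝ) := by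
  have h2 : 2 ≤ N + 1 := by omega
  have hχm : Measurable χ := hχ.measurable
  have hXi := XiN_pos hs.σ_pos.le hs.σ_lt_half hs.ovDensity_lt_one (N := N) (m := N + 1) le_rfl
  rw [XiN] at hXi
  rw [integral_posGibbsMeasure_const ha, inv_mul_eq_div,
    variance_identity uniformProfile (hsDiameter σ N) h2 hχm hK (∫ y, χ y) hXi.ne',
    mesoVar_Md_uniform (χ := fun y => χ y ^ 2) (by fun_prop) (N + 1), mesoVar_Md_uniform hχ,
    mul_div_assoc (∫ y, χ y ^ 2), mul_div_assoc (∫ y, χ y), div_self hXi.ne', mul_one, mul_one]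
  have htwo : (∫ x, χ (x 0) * χ (x ⟨1, h2⟩) * efR (Ov (hsDiameter σ N)) x Finset.univ
      ∂Measure.pi (fun _ : Fin (N + 1) => uniformProfile.μ)) /
      Xi uniformProfile (hsDiameter σ N) (N + 1) (N + 1) = twoPt uniformProfile σ χ N := by
    rw [twoPt, dif_pos h2, XiN]
  rw [htwo]
  have hcov := mesoVar_abs_twoPt_uniform_sub_sq_le hs hχ hK hN
  -- elementary facts
  have hK0 : 0 ≤ K := (abs_nonneg _).trans (hK 0)
  have hL0 : 0 ≤ ∫ y, |χ y| := integral_nonneg fun _ => abs_nonneg _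
  have hIK : |∫ y, χ y| ≤ K := by
    refine (abs_integral_le_integral_abs).trans ?_
    calc ∫ y, |χ y| ≤ ∫ _ : T3, K := integral_mono (integrable_of_continuous_T3 hχ.abs)
          (integrable_const K) hK
      _ = K := by rw [integral_const, smul_eq_mul, probReal_univ, one_mul]
  have hQ : ∫ y, χ y ^ 2 ≤ K * ∫ y, |χ y| := by
    rw [← integral_const_mul]
    refine integral_mono (integrable_of_continuous_T3 (hχ.pow 2))
      ((integrable_of_continuous_T3 hχ.abs).const_mul K) fun y => ?_
    dsimp only
    rw [← sq_abs]
    nlinarith [abs_nonneg (χ y), hK y]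
  have hθ0 := hs.geomRatio_nonneg
  have hθ1 := hs.geomRatio_lt_one
  have hl0 := hs.ovDensity_nonneg
  set n : ℝ := ((N + 1 : ℕ) : ℝ) with hn
  set I : ℝ := ∫ y, χ y with hI
  set L : ℝ := ∫ y, |χ y| with hL
  set Q : ℝ := ∫ y, χ y ^ 2 with hQdef
  set T : ℝ := twoPt uniformProfile σ χ N with hT
  set S : ℝ := geomRatio uniformProfile σ / (1 - geomRatio uniformProfile σ) ^ 2 +
    (1 - geomRatio uniformProfile σ)⁻¹ with hS
  set lam : ℝ := ovDensity uniformProfile σ with hlam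
  have hS0 : 0 ≤ S := by
    rw [hS]
    have h1 : 0 < 1 - geomRatio uniformProfile σ := by linarith
    positivity
  have hn0 : 0 < n := by rw [hn]; positivity
  have hu0 : 0 ≤ n⁻¹ := inv_nonneg.2 hn0.le
  have hu1 : n⁻¹ ≤ 1 := by
    rw [hn]
    exact inv_le_one_of_one_le₀ (by exact_mod_cast Nat.succ_le_succ (Nat.zero_le N))
  have e1 : n⁻¹ * Q + (1 - n⁻¹) * T - 2 * I * I + I ^ 2 = n⁻¹ * (Q - I ^ 2) + (1 - n⁻¹) * (T - I ^ 2) := by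
    ring
  have e2 : (1 - n⁻¹) * (T - I ^ 2) ≤ |T - I ^ 2| :=
    (mul_le_mul_of_nonneg_left (le_abs_self _) (by linarith)).trans
      (mul_le_of_le_one_left (abs_nonneg _) (by linarith))
  have e3 : n⁻¹ * (Q - I ^ 2) ≤ n⁻¹ * (K * L) :=
    mul_le_mul_of_nonneg_left (by nlinarith [sq_nonneg I]) hu0
  have e5 : 4 * Real.exp 1 ^ 2 * S * (lam / n) * (L * (K + |I|)) ≤
      4 * Real.exp 1 ^ 2 * S * (lam / n) * (L * (2 * K)) :=
    mul_le_mul_of_nonneg_left (mul_le_mul_of_nonneg_left (by linarith) hL0)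
      (by have := div_nonneg hl0 hn0.le; positivity)
  have e6 : 4 * Real.exp 1 ^ 2 * S * (lam / n) * (L * (2 * K)) = n⁻¹ * (K * L) * (8 * Real.exp 1 ^ 2 * S * lam) := by
    rw [div_eq_mul_inv]
    ring
  rw [e1, div_eq_mul_inv]
  calc n⁻¹ * (Q - I ^ 2) + (1 - n⁻¹) * (T - I ^ 2)
      ≤ n⁻¹ * (K * L) + n⁻¹ * (K * L) * (8 * Real.exp 1 ^ 2 * S * lam) := by
        linarith [e2, e3, hcov, e5, e6]
    _ = K * L * (1 + 8 * Real.exp 1 ^ 2 * S * lam) * n⁻¹ := by ring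

/-! ## §4 From the canonical gas to the homogeneous local Gibbs law along any flow -/

/-- **The position marginal of the homogeneous local Gibbs law is the canonical gas** (`a, θ > 0`):
`q_# G_N = P_N` for `q(z) = (xᵢ)ᵢ` (rung-0 product structure `localGibbsMeasure_rung0_eq_map`). -/
theorem mesoVar_measurePreserving_pos {a θ : ℝ} (u : V3) (ha : 0 < a) (hθ : 0 < θ)
    (N : ℕ) (Φ : HardSphereFlow (Torus.geometry (Fin 3)) (hsDiameter σ N) (N + 1)) :
    MeasurePreserving (fun z : Cfg N => fun i => (z i).1)
      (localGibbsLaw σ (fun _ => a) (fun _ => u) (fun _ => θ) N Φ)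
      (posGibbsMeasure (fun _ : T3 => a) (hsDiameter σ N) (N + 1)) := by
  have hm : Measurable (fun z : Cfg N => fun i => (z i).1) :=
    measurable_pi_lambda _ fun i => (measurable_pi_apply i).fst
  refine ⟨hm, ?_⟩
  rw [localGibbsLaw_eq, localGibbsMeasure_rung0_eq_map σ ha.le hθ u N, Measure.map_map hm measurable_zipConfig]
  have hcomp : (fun z : Cfg N => fun i => (z i).1) ∘ zipConfig =
      (Prod.fst : (Fin (N + 1) → T3) × (Fin (N + 1) → V3) → Fin (N + 1) → T3) := by
    funext p
    rfl
  rw [hcomp, Measure.map_fst_prod, measure_univ, one_smul]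

/-- **Poisson-order variance of the kernel block density under the homogeneous law, along ANY flow.**  For
small reduced density (`SmallDensity uniformProfile σ`), `a, θ > 0`, `N ≥ 1`, every hard-sphere flow `Φ` of
`N + 1` spheres, every time `s`, centre `x` and continuous kernel `φ` with `|φ| ≤ K`:
`Var_{G_N} ρ̄_φ(s, x) ≤ K ‖φ‖₁ (1 + 8e²Sλ)/(N+1)`.  Flow invariance of `G_N`
(`measurePreserving_flow_localGibbsLaw_const`) removes `s`; the observable is positional and the position
marginal is the canonical gas (`mesoVar_measurePreserving_pos`); `Var X ≤ E(X − ∫φ)²`; statics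
(`mesoVar_posGibbs_sq_dev_le` with `χ = φ(· − x)`, `‖χ‖₁ = ‖φ‖₁`). -/
theorem mesoVar_variance_blockDensity_flow_le (hs : SmallDensity uniformProfile σ) {a θ : ℝ} (ha : 0 < a)
    (hθ : 0 < θ) (u : V3) {N : ℕ} (hN : 1 ≤ N)
    (Φ : HardSphereFlow (Torus.geometry (Fin 3)) (hsDiameter σ N) (N + 1)) {φ : T3 → ℝ} (hφ : Continuous φ)
    {K : ℝ} (hK : ∀ y, |φ y| ≤ K) (s : ℝ) (x : T3) :
    variance (fun z => empiricalDensityField (Φ.flow s z) (fun y => φ (y - x)))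
        (localGibbsLaw σ (fun _ => a) (fun _ => u) (fun _ => θ) N Φ) ≤
      (K * ∫ y, |φ y|) * (1 + 8 * Real.exp 1 ^ 2 *
        (geomRatio uniformProfile σ / (1 - geomRatio uniformProfile σ) ^ 2 +
          (1 - geomRatio uniformProfile σ)⁻¹) * ovDensity uniformProfile σ) / ((N + 1 : ℕ) : ℝ) := by
  set G := localGibbsLaw σ (fun _ => a) (fun _ => u) (fun _ => θ) N Φ with hG
  set Ppos := posGibbsMeasure (fun _ : T3 => a) (hsDiameter σ N) (N + 1) with hPpos
  have hσ2 : σ ≤ 1 / 2 := hs.σ_lt_half.le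
  haveI : IsProbabilityMeasure G := isProbabilityMeasure_localGibbsLaw continuous_const continuous_const
    continuous_const (fun _ => ha) (fun _ => hθ) hσ2 N Φ
  haveI : IsProbabilityMeasure Ppos := isProbabilityMeasure_posGibbsMeasure continuous_const (fun _ => ha) hσ2 N
  set χ : T3 → ℝ := fun y => φ (y - x) with hχ
  have hχc : Continuous χ := hφ.comp (continuous_sub_right x)
  have hχK : ∀ y, |χ y| ≤ K := fun y => hK _
  set Fq : (Fin (N + 1) → T3) → ℝ := fun q => (((N + 1 : ℕ) : ℝ))⁻¹ * ∑ i, χ (q i) with hFq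
  have hFqm : Measurable Fq :=
    measurable_const.mul (Finset.measurable_sum _ fun i _ => hχc.measurable.comp (measurable_pi_apply i))
  have hF : (fun z : Cfg N => empiricalDensityField z (fun y => φ (y - x))) = fun z => Fq (fun i => (z i).1) :=
    funext fun z => AprioriBoundsNegative.blockDensity_eq z φ x
  -- (1) flow invariance removes the time
  have h1 : variance (fun z => empiricalDensityField (Φ.flow s z) (fun y => φ (y - x))) G =
      variance (fun z : Cfg N => empiricalDensityField z (fun y => φ (y - x))) G :=
    (measurePreserving_flow_localGibbsLaw_const σ a θ u N Φ s).variance_fun_comp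
      (measurable_blockDensity_cfg hφ x).aemeasurable
  -- (2) the position marginal
  have h2 : variance (fun z : Cfg N => empiricalDensityField z (fun y => φ (y - x))) G = variance Fq Ppos := by
    rw [hF]
    exact (mesoVar_measurePreserving_pos u ha hθ N Φ).variance_fun_comp hFqm.aemeasurable
  -- (3) `Var X ≤ E (X - ∫χ)²`
  have h3 : variance Fq Ppos ≤ ∫ q, (Fq q - ∫ y, χ y) ^ 2 ∂Ppos := by
    rw [← variance_sub_const hFqm.aestronglyMeasurable (∫ y, χ y)]
    have h := variance_le_expectation_sq (μ := Ppos) (X := fun q => Fq q - ∫ y, χ y)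
      (hFqm.aestronglyMeasurable.sub aestronglyMeasurable_const)
    simpa only [Pi.pow_apply] using h
  -- (4) statics
  have h4 := mesoVar_posGibbs_sq_dev_le hs ha hN hχc hχK
  have hL : ∫ y, |χ y| = ∫ y, |φ y| := integral_sub_right_eq_self (fun y => |φ y|) x
  rw [h1, h2, ← hL]
  exact h3.trans h4

end TwoPoint

/-! ## §5 The equilibrium instance of stub `stub_mesoVariance` -/

/-- **`stub_mesoVariance` AT CONSTANT DATA, FOR EVERY FLOW FAMILY AND HORIZON** (anchor
`mesoVariance_homogeneous` of the line `meso-chebyshev-window`; the registered stub's conclusion block verbatim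
with the profiles specialised to positive constants `(a₀, u₀, θ₀) ≡ (a, u, θ)`).  There is `σ₀ > 0`
(`exists_smallDensity uniformProfile`: the low-density regime of the canonical cluster expansion, `σ₀ < 1/2`) such
that for `0 < σ < σ₀`, `a, θ > 0`, EVERY flow family, every `t`, `γ > 0` and every admissible kernel family,
with `A := C (1 + 8e²S(σ)λ(σ))` and `N₀ := 1`: for all `N ≥ 1`, `s`, `x`, the block density
`ρ̄_φ(s,x) = (N+1)⁻¹∑ᵢ φ_N(qᵢ(s) − x)` is in `L²(G_N)` (bounded by `C(N+1)^{3γ}`, measurable) and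
`Var_{G_N} ρ̄_φ(s,x) ≤ A (N+1)^{3γ−1}` — POISSON ORDER (`mesoVar_variance_blockDensity_flow_le` with
`K = C(N+1)^{3γ}`, `‖φ_N‖₁ = 1`).  Only continuity (from smoothness), positivity, unit mass and the height bound
of the kernel block are used; `γ ≤ 1/15`, the support and gradient clauses are idle. -/
theorem mesoVariance_homogeneous : ∃ σ₀ : ℝ, 0 < σ₀ ∧ ∀ (σ a θ : ℝ) (u : V3), 0 < σ → σ < σ₀ → 0 < a → 0 < θ → ∀ (Φ : (N : ℕ) → HardSphereFlow (Torus.geometry (Fin 3)) (hsDiameter σ N) (N + 1)) (t γ C : ℝ) (φ : ℕ → T3 → ℝ), 0 < γ → γ ≤ 1 / 15 → ((∀ N, Literature.Analysis.FunctionSpaces.Torus.IsSmooth (φ N)) ∧ (∀ N y, 0 ≤ φ N y) ∧ (∀ N, ∫ y, φ N y = 1) ∧ (∀ (N : ℕ) y, ((N : ℝ) + 1) ^ (-γ) ≤ Torus.euclidDist y 0 → φ N y = 0) ∧ (∀ (N : ℕ) y, φ N y ≤ C * ((N : ℝ) + 1) ^ (3 * γ)) ∧ (∀ (N : ℕ)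 y, ‖Literature.Analysis.FunctionSpaces.Torus.gradient (φ N) y‖ ≤ C * ((N : ℝ) + 1) ^ (4 * γ))) → ∃ A : ℝ, ∃ N₀ : ℕ, ∀ N : ℕ, N₀ ≤ N → ∀ s ∈ Icc 0 t, ∀ x : T3, MemLp (fun z => empiricalDensityField ((Φ N).flow s z) (fun y => φ N (y - x))) 2 (localGibbsLaw σ (fun _ => a) (fun _ => u) (fun _ => θ) N (Φ N)) ∧ variance (fun z => empiricalDensityField ((Φ N).flow s z) (fun y => φ N (y - x))) (localGibbsLaw σ (fun _ => a) (fun _ => u) (fun _ => θ) N (Φ N)) ≤ A * ((N : ℝ) + 1) ^ (3 * γ - 1) := by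
  obtain ⟨σ₀, hσ₀, hsd⟩ := exists_smallDensity uniformProfile one_pos
  refine ⟨σ₀, hσ₀, ?_⟩
  intro σ a θ u hσ hσσ₀ ha hθ Φ t γ C φ _ _ hadm
  obtain ⟨hsm, hpos, hmass, -, hle, -⟩ := hadm
  have hs : SmallDensity uniformProfile σ := (hsd σ hσ hσσ₀).1
  have hσ2 : σ ≤ 1 / 2 := hs.σ_lt_half.le
  set B : ℝ := 1 + 8 * Real.exp 1 ^ 2 *
    (geomRatio uniformProfile σ / (1 - geomRatio uniformProfile σ) ^ 2 + (1 - geomRatio uniformProfile σ)⁻¹) *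
      ovDensity uniformProfile σ with hB
  refine ⟨C * B, 1, fun N hN s _ x => ?_⟩
  have hK : ∀ y, |φ N y| ≤ C * ((N : ℝ) + 1) ^ (3 * γ) := fun y =>
    abs_le.2 ⟨by linarith [hpos N y, hle N y], hle N y⟩
  haveI : IsProbabilityMeasure (localGibbsLaw σ (fun _ => a) (fun _ => u) (fun _ => θ) N (Φ N)) :=
    isProbabilityMeasure_localGibbsLaw continuous_const continuous_const continuous_const
      (fun _ => ha) (fun _ => hθ) hσ2 N (Φ N)
  refine ⟨?_, ?_⟩
  · exact memLp_of_bounded (a := -(C * ((N : ℝ) + 1) ^ (3 * γ))) (b := C * ((N : ℝ) + 1) ^ (3 * γ))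
      (ae_of_all _ fun z => abs_le.1 (abs_blockDensity_le hK ((Φ N).flow s z) x))
      (((measurable_blockDensity_cfg (hsm N).continuous x).comp ((Φ N).measurable_flow s)).aestronglyMeasurable) 2
  · have hv := mesoVar_variance_blockDensity_flow_le hs ha hθ u hN (Φ N) (hsm N).continuous hK s x
    have hL1 : ∫ y, |φ N y| = 1 := by
      simp_rw [abs_of_nonneg (hpos N _)]
      exact hmass N
    rw [hL1, mul_one] at hv
    refine hv.trans (le_of_eq ?_)
    have hN0 : (0 : ℝ) < (N : ℝ) + 1 := by positivity
    rw [Real.rpow_sub hN0, Real.rpow_one]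
    push_cast
    ring

end Summit.AtomisticToContinuum.HydrodynamicLimit.Theorems.MesoChebyshevWindow

end
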